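import Mathlib
import Summits.Ventures.PercRepro2.Defs
import Summits.Ventures.PercRepro2.Graph
import Summits.Ventures.PercRepro2.OneColourSwitch
import Summits.Ventures.PercRepro2.RegionHubSign
import Summits.Ventures.PercRepro2.SideSwitch
import Summits.Ventures.PercRepro2.SideSwitchFibre
import Summits.Ventures.PercRepro2.SideSwitchMono
import Summits.Ventures.PercRepro2.SideSwitchM9
import Summits.Ventures.PercRepro2.SideSwitchClosed
import Summits.Ventures.PercRepro2.SideSwitchComps
import Summits.Ventures.PercRepro2.TermSwitchDefs
import Summits.Ventures.PercRepro2.TermSwitchFibre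
import Summits.Ventures.PercRepro2.TermSwitchCompsFibre
import Summits.Ventures.PercRepro2.TermSwitchMono
import Summits.Ventures.PercRepro2.TermSwitchM9
import Summits.Ventures.PercRepro2.TermSwitchRestrict

/-!
# «`d` is reached from `{r, s}`» is fibre data of the three-terminal fibration (blind cell
PercRepro2, p3 g21, 2026-08-27; `proofs/P3-CPNC.md` §18g (3), §18h)

For the terminal set `{r, s, d}`, the predicate `Reached r s d ω := d ∈ K₂ ∪ M₂` (`d` reached
from `{r, s}` in some colour) is constant along the component assignments of every
representative (`reached_flipTouch_iff`: a monochromatic path from `r` or `s` to `d` runs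
`r → one block → d`, and the switch of the block flips the whole path; in the kernel a closedness
argument on the set of vertices reached «in the block's colour») and invariant under the outside
flip (`reached_flipOH_iff`).  Hence, by `TermSwitchRestrict`, the three-terminal sums over the
colourings with `d` reached, and over those with `d` unreached, are each non-positive
(`dzeroSignSumHP_reached_nonpos`, `dzeroSignSumHP_unreached_nonpos`).  Own work; std axioms.
-/

namespace Summit.Ventures.PercRepro2

namespace TermSwitch

open Finset Classical RegionHub OneColourSwitch SideSwitch

variable {V : Type*} {E : Type*}

variable (ends : E → Sym2 V)

/-- `d` is reached from `{r, s}` in some colour. -/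
def Reached (r s d : V) (ω : Config E) : Prop := d ∈ K2 ends r s ω ∪ M2 ends r s ω

variable {ends}

/-- `Reached` is invariant under the colour flip. -/
lemma reached_compl {r s d : V} {ω : Config E} :
    Reached ends r s d (OneColourSwitch.compl ω) ↔ Reached ends r s d ω := by
  simp only [Reached, K2_compl, M2_compl, Set.mem_union]
  exact or_comm

/-- `r` is a terminal of `{r, s, d}`. -/
lemma r_mem_triple (r s d : V) : r ∈ ({r, s, d} : Set V) := Set.mem_insert r _

/-- `s` is a terminal of `{r, s, d}`. -/
lemma s_mem_triple (r s d : V) : s ∈ ({r, s, d} : Set V) :=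
  Set.mem_insert_of_mem r (Set.mem_insert s _)

/-- `d` is a terminal of `{r, s, d}`. -/
lemma d_mem_triple (r s d : V) : d ∈ ({r, s, d} : Set V) :=
  Set.mem_insert_of_mem r (Set.mem_insert_of_mem s (Set.mem_singleton d))

/-- A terminal of `{r, s, d}` other than `d` is `r` or `s`. -/
lemma eq_r_or_s_of_mem_triple {r s d y : V} (hy : y ∈ ({r, s, d} : Set V)) (hyd : y ≠ d) :
    y = r ∨ y = s := by
  rcases Set.mem_insert_iff.1 hy with h | h
  · exact Or.inl h
  rcases Set.mem_insert_iff.1 h with h | h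
  · exact Or.inr h
  · exact absurd (Set.mem_singleton_iff.1 h) hyd

/-- **The one-step transfer**: for the terminal set `{r, s, d}` and a set `C` closed inside the
sided set and avoiding the terminals, if `d` is `Y`-reached from `{r, s}` in `ω` then `d` is
reached (in some colour) in `ω ⊕ touches C`.  The closedness argument runs on the vertices
reached from `r` or `s` in the switched colouring «in the block's colour» (`W` inside `C`, `Y`
outside), stopping at the first visit of `d`. -/
lemma reached_flipTouch_of_mem_K2 {r s d : V} (hrd : r ≠ d) (hsd : s ≠ d) {ω : Config E}
    {C : Set V} (hCH : ∀ x ∈ C, x ∉ ({r, s, d} : Set V))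
    (hcl : ClosedIn ends (sidedH ends ({r, s, d} : Set V) ω) C)
    (hd : d ∈ K2 ends r s ω) : Reached ends r s d (flipTouch ends C ω) := by
  set ω' := flipTouch ends C ω with hω'
  have hr : r ∈ ({r, s, d} : Set V) := r_mem_triple r s d
  have hs : s ∈ ({r, s, d} : Set V) := s_mem_triple r s d
  have hdC : d ∉ C := fun h => hCH d h (d_mem_triple r s d)
  have hrC : r ∉ C := fun h => hCH r h hr
  have hmem : ∀ {e : E}, e ∈ touches ends C → ω' e = !ω e := fun het => by
    rw [hω', flipTouch_of_mem ends het]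
  have hnot : ∀ {e : E}, e ∉ touches ends C → ω' e = ω e := fun hnt => by
    rw [hω', flipTouch_of_notMem ends hnt]
  let Z : Set V := {x | Reached ends r s d ω' ∨
    (x ≠ d ∧ ((x ∈ C ∧ x ∈ M2 ends r s ω') ∨ (x ∉ C ∧ x ∈ K2 ends r s ω')))}
  have hcl' : ∀ x ∈ Z, ∀ y, (openGraph ends ω).Adj x y → y ∈ Z := by
    intro x hx y hxy
    obtain ⟨_, e, he, hends⟩ := openGraph_adj.1 hxy
    rcases hx with hR | ⟨hxd, hx⟩
    · exact Or.inl hR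
    have hyx : ends e = s(y, x) := by rw [hends, Sym2.eq_swap]
    by_cases hyd : y = d
    · -- `y = d`: `d` is reached in `ω'`
      subst hyd
      refine Or.inl ?_
      rcases hx with ⟨hxC, hxM⟩ | ⟨hxC, hxK⟩
      · have het : e ∈ touches ends C := mem_touches_of_ends hends (Or.inl hxC)
        have he0 : ω' e = false := by rw [hmem het, he]; rfl
        exact Or.inr (mem_M2_of_closed hxM he0 hends)
      · have hnt : e ∉ touches ends C := not_mem_touches_of_ends hends hxC hdC
        have he1 : ω' e = true := by rw [hnot hnt]; exact he
        exact Or.inl (mem_K2_of_open hxK he1 hends)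
    · refine Or.inr ⟨hyd, ?_⟩
      rcases hx with ⟨hxC, hxM⟩ | ⟨hxC, hxK⟩
      · by_cases hyC : y ∈ C
        · have het : e ∈ touches ends C := mem_touches_of_ends hends (Or.inl hxC)
          have he0 : ω' e = false := by rw [hmem het, he]; rfl
          exact Or.inl ⟨hyC, mem_M2_of_closed hxM he0 hends⟩
        · -- `y ∉ C` adjacent to `x ∈ C`: `y` is a terminal other than `d`
          have hxKH : x ∈ KH ends ({r, s, d} : Set V) ω := by
            have hxM' : x ∈ MH ends ({r, s, d} : Set V) ω' :=
              K2_subset_KH hr hs (OneColourSwitch.compl ω') hxM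
            rw [MH_flipTouch_of_closed hCH hcl] at hxM'
            rcases hxM' with ⟨_, hxC'⟩ | ⟨_, hxK⟩
            · exact (hxC' hxC).elim
            · exact hxK
          have hyH : y ∈ ({r, s, d} : Set V) := by
            by_contra hyH
            have hys : y ∉ sidedH ends ({r, s, d} : Set V) ω :=
              fun hsd' => hyC (hcl e x y hends hxC hsd')
            exact hys ⟨Or.inl (mem_KH_of_open hxKH he hends), hyH⟩
          refine Or.inr ⟨hyC, ?_⟩
          rcases eq_r_or_s_of_mem_triple hyH hyd with rfl | rfl
          · exact r_mem_K2 _ _ _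
          · exact s_mem_K2 _ _ _
      · by_cases hyC : y ∈ C
        · -- `x ∉ C` adjacent to `y ∈ C`: `x` is `r` or `s`, the edge is `W` in `ω'`
          have hxH : x ∈ ({r, s, d} : Set V) := by
            by_contra hxH
            have hxs : x ∉ sidedH ends ({r, s, d} : Set V) ω :=
              fun hsd' => hxC (hcl e y x hyx hyC hsd')
            have hxU : x ∈ KH ends ({r, s, d} : Set V) ω' ∪ MH ends ({r, s, d} : Set V) ω' :=
              Or.inl (K2_subset_KH hr hs ω' hxK)
            rw [UH_flipTouch_of_closed hCH hcl] at hxU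
            exact hxs ⟨hxU, hxH⟩
          have het : e ∈ touches ends C := mem_touches_of_ends hends (Or.inr hyC)
          have he0 : ω' e = false := by rw [hmem het, he]; rfl
          refine Or.inl ⟨hyC, ?_⟩
          rcases eq_r_or_s_of_mem_triple hxH hxd with rfl | rfl
          · exact mem_M2_of_closed (r_mem_M2 _ _ _) he0 hends
          · exact mem_M2_of_closed (s_mem_M2 _ _ _) he0 hends
        · have hnt : e ∉ touches ends C := not_mem_touches_of_ends hends hxC hyC
          have he1 : ω' e = true := by rw [hnot hnt]; exact he
          exact Or.inr ⟨hyC, mem_K2_of_open hxK he1 hends⟩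
  have hrZ : r ∈ Z := Or.inr ⟨hrd, Or.inr ⟨hrC, r_mem_K2 r s ω'⟩⟩
  have hsC : s ∉ C := fun h => hCH s h hs
  have hsZ : s ∈ Z := Or.inr ⟨hsd, Or.inr ⟨hsC, s_mem_K2 r s ω'⟩⟩
  have hdZ : d ∈ Z := by
    rcases mem_K2_iff.1 hd with hc | hc
    · exact mem_of_conn_of_closed hcl' hrZ hc
    · exact mem_of_conn_of_closed hcl' hsZ hc
  rcases hdZ with hR | ⟨hdd, _⟩
  · exact hR
  · exact absurd rfl hdd

/-- The one-step transfer from either colour. -/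
lemma reached_flipTouch_of_reached {r s d : V} (hrd : r ≠ d) (hsd : s ≠ d) {ω : Config E}
    {C : Set V} (hCH : ∀ x ∈ C, x ∉ ({r, s, d} : Set V))
    (hcl : ClosedIn ends (sidedH ends ({r, s, d} : Set V) ω) C)
    (hd : Reached ends r s d ω) : Reached ends r s d (flipTouch ends C ω) := by
  rcases hd with hK | hM
  · exact reached_flipTouch_of_mem_K2 hrd hsd hCH hcl hK
  · have hcl' : ClosedIn ends (sidedH ends ({r, s, d} : Set V) (OneColourSwitch.compl ω)) C := by
      rw [sidedH_compl]; exact hcl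
    have hK : d ∈ K2 ends r s (OneColourSwitch.compl ω) := by rw [K2_compl]; exact hM
    have := reached_flipTouch_of_mem_K2 hrd hsd hCH hcl' hK
    rw [← compl_flipTouch, reached_compl] at this
    exact this

/-- **`Reached` is constant along the switch of a closed set.** -/
lemma reached_flipTouch_iff {r s d : V} (hrd : r ≠ d) (hsd : s ≠ d) {ω : Config E}
    {C : Set V} (hCH : ∀ x ∈ C, x ∉ ({r, s, d} : Set V))
    (hcl : ClosedIn ends (sidedH ends ({r, s, d} : Set V) ω) C) :
    Reached ends r s d (flipTouch ends C ω) ↔ Reached ends r s d ω := by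
  constructor
  · intro h
    have hcl' : ClosedIn ends (sidedH ends ({r, s, d} : Set V) (flipTouch ends C ω)) C := by
      rw [sidedH_flipTouch_of_closed hCH hcl]; exact hcl
    have := reached_flipTouch_of_reached hrd hsd hCH hcl' h
    rw [flipTouch_flipTouch] at this
    exact this
  · exact reached_flipTouch_of_reached hrd hsd hCH hcl

/-- The `Y`-world of `{r, s}` ignores the edges inside the outside of a terminal set
containing `r, s`. -/
lemma K2_flipIn_OsetH {r s : V} {H : Set V} (hr : r ∈ H) (hs : s ∈ H) (ω : Config E) :
    K2 ends r s (flipIn ends (OsetH ends H ω) ω) = K2 ends r s ω := by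
  apply expl_eq_of_eqOn_touches
  intro e he
  obtain ⟨x, hx, y, hxy⟩ := he
  have hxK : x ∈ KH ends H ω := K2_subset_KH hr hs ω hx
  have hnot : e ∉ within ends (OsetH ends H ω) :=
    not_mem_within_OsetH_of_mem_touches ⟨x, Or.inl hxK, y, hxy⟩
  rw [flipIn_of_notMem hnot]

/-- The `W`-world of `{r, s}` ignores the edges inside the outside of a terminal set
containing `r, s`. -/
lemma M2_flipIn_OsetH {r s : V} {H : Set V} (hr : r ∈ H) (hs : s ∈ H) (ω : Config E) :
    M2 ends r s (flipIn ends (OsetH ends H ω) ω) = M2 ends r s ω := by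
  rw [M2, compl_flipIn, ← K2, ← OsetH_compl, K2_flipIn_OsetH hr hs, K2_compl]

section Count

variable [Fintype V] [DecidableEq V] [Fintype E] [DecidableEq E]

omit [Fintype E] [DecidableEq E] in
/-- `Reached` is constant along the component assignments of the three-terminal fibration. -/
lemma reached_assignC_iff {r s d : V} (hrd : r ≠ d) (hsd : s ≠ d) {ρ : Config E}
    {T : Finset (Finset V)} (hT : T ⊆ compsH ends ({r, s, d} : Set V) ρ) :
    Reached ends r s d (assignC ends T ρ) ↔ Reached ends r s d ρ := by
  obtain ⟨_, h2, h3⟩ := switch_data_unionT_H hT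
  exact reached_flipTouch_iff hrd hsd h2 h3

omit [Fintype V] [DecidableEq V] [Fintype E] [DecidableEq E] in
/-- `Reached` is invariant under the outside flip of the three-terminal fibration. -/
lemma reached_flipOH_iff {r s d : V} (ρ : Config E) :
    Reached ends r s d (flipOH ends ({r, s, d} : Set V) ρ) ↔ Reached ends r s d ρ := by
  simp only [Reached, flipOH, K2_flipIn_OsetH (r_mem_triple r s d) (s_mem_triple r s d),
    M2_flipIn_OsetH (r_mem_triple r s d) (s_mem_triple r s d)]

/-- **The three-terminal sum over the colourings with `d` reached from `{r, s}` is
non-positive**: `Σ_{ω ∈ Sep₃ ∩ DZero₃, d ∈ K₂ ∪ M₂} σ_pq · σ_rs ≤ 0`. -/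
theorem dzeroSignSumHP_reached_nonpos (p q : V) {r s d : V} (hrd : r ≠ d) (hsd : s ≠ d) :
    dzeroSignSumHP ends p q r s ({r, s, d} : Set V) (Reached ends r s d) ≤ 0 :=
  dzeroSignSumHP_nonpos p q s (r_mem_triple r s d) (Reached ends r s d)
    (fun _ _ _ hT => reached_assignC_iff hrd hsd hT)
    (fun ρ _ => reached_flipOH_iff ρ)

/-- **The three-terminal sum over the colourings with `d` unreached from `{r, s}` is
non-positive**: `Σ_{ω ∈ Sep₃ ∩ DZero₃, d ∉ K₂ ∪ M₂} σ_pq · σ_rs ≤ 0`. -/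
theorem dzeroSignSumHP_unreached_nonpos (p q : V) {r s d : V} (hrd : r ≠ d) (hsd : s ≠ d) :
    dzeroSignSumHP ends p q r s ({r, s, d} : Set V) (fun ω => ¬ Reached ends r s d ω) ≤ 0 :=
  dzeroSignSumHP_nonpos p q s (r_mem_triple r s d) (fun ω => ¬ Reached ends r s d ω)
    (fun _ _ _ hT => not_congr (reached_assignC_iff hrd hsd hT))
    (fun ρ _ => not_congr (reached_flipOH_iff ρ))

end Count

end TermSwitch

end Summit.Ventures.PercRepro2
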